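import Mathlib
import HarnessLib
import Summits.HubbardSuperconductivity.HubbardSuperconductivity.Theorems.KLProgrammeKLRegimeEngineTowerChernoff

/-!
# Route `KLProgramme` — crux K3 ENGINE (stmt-HubbardSuperconductivity-20437 `KLRegimeEngineV17F2`), stub (b): the blocked-tower bookkeeping,
# part 6 — the QUARTIC INCREMENT of a block step is `O(λ²)` (E1 lead r2d-p2 g5; plan g17 KL l.3017 (iii), the (E4)ₙ chain's W2)

The tower never OUTPUTS the quartic law (memo E1-TOWER-BLOCKED §6: the quartic is the value line's import), but the (E4)ₙ/(E5-F)ₙ chains read the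
quartic INCREMENT born in one block step, per fixed external tuple, and need it `O((Klam·U)²)` and `n`-free.  At output degree `2p = 4` the Chernoff
form of parts 4/5 is too lossy (it over-charges the one-loop bubble by `w = (2τQ'λ)⁻¹`); the honest bookkeeping is simpler: EVERY input of the step is
`O(λ)` — two legs `ι₁λ`, four legs `ι₂λ`, `2m ≥ 6` legs `A'λ^{m−1}Q'^m` — so the order-`n` graded term carries `λⁿ ≤ λ²` (`n ≥ 2`) with the leg
constraint simply DROPPED, and the first order (self-contractions of the `2m ≥ 6` kernels) carries `λ^{m−1} ≤ λ²`:

* `towerS_le_pow_of_le_mul` — `μ m ≤ λ·ν m` on `[1,D]` ⇒ `towerS D τ μ n p ≤ λⁿ·(Σ_{δ∈[1,D]} τ^δ ν δ)ⁿ` (Chernoff at `w = 1`);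
* `sum_nu_threePiece_le` — for `ν 1 = ι₁`, `ν 2 = ι₂`, `ν m = A'λ^{m−2}Q'^m` (`m ≥ 3`): `Σ_δ τ^δ ν δ ≤ τι₁ + τ²ι₂ + A'λ(τQ')³/(1−τλQ')`;
* **`towerQuarticIncrement_le`** — with `μ m ≤ λ·ν m` (`1 ≤ m ≤ D`), `Σ_δ τ^δ ν δ ≤ G′`, the recursive profile in degrees `2m ≥ 6` (for the first order),
  `x₁ = 4σλQ' < 1`, `Φ·λ·G′ < 1`, `towerV ≤ V̄`, `ΦV̄ < 1`, and the suppliers' step hypothesis at `p = 2`: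
  **`b ≤ λ²·(64·A'σQ'³/(1 − x₁) + e·ψ²·Φ·G′²/(1 − ΦλG′))`** — `n`-free, no `λ`-free smallness.
Currency-blind (plain or `klScaleWt`-weighted pinned sums alike, given the suppliers); the all-external-labels-fixed tuple is dominated by the
one-leg-pinned sum.  Pure real analysis; nothing about the model is asserted.
-/

noncomputable section

namespace Summit.HubbardSuperconductivity.HubbardSuperconductivity.Theorems.EngineV8

set_option linter.dupNamespace false -- summit = problem name (single-conjunct summit), D-0017

open Real Finset

/-- **Graded sum with every input `O(λ)`**: `μ m ≤ λ·ν m` on `[1, D]` (`0 ≤ μ, ν, λ, τ`) ⇒ `towerS D τ μ n p ≤ λⁿ · (Σ_{δ∈[1,D]} τ^δ ν δ)ⁿ` — the leg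
constraint dropped, the product sum factorised (`towerS_le_chernoff` at `w = 1`). -/
theorem towerS_le_pow_of_le_mul {D : ℕ} {τ lam : ℝ} {μ ν : ℕ → ℝ} (hτ : 0 ≤ τ) (hμ0 : ∀ m, 0 ≤ μ m)
    (hμν : ∀ m, 1 ≤ m → m ≤ D → μ m ≤ lam * ν m) (n p : ℕ) :
    towerS D τ μ n p ≤ lam ^ n * (∑ δ ∈ Icc 1 D, τ ^ δ * ν δ) ^ n := by
  have h := towerS_le_chernoff (D := D) hτ hμ0 le_rfl n p
  simp only [one_pow, inv_one, one_mul, mul_one] at h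
  refine h.trans ?_
  have hS0 : 0 ≤ ∑ δ ∈ Icc 1 D, τ ^ δ * μ δ := sum_nonneg fun δ _ => by have := hμ0 δ; positivity
  have hle : ∑ δ ∈ Icc 1 D, τ ^ δ * μ δ ≤ lam * ∑ δ ∈ Icc 1 D, τ ^ δ * ν δ := by
    rw [mul_sum]
    refine sum_le_sum fun δ hδ => ?_
    have := hμν δ (mem_Icc.1 hδ).1 (mem_Icc.1 hδ).2
    calc τ ^ δ * μ δ ≤ τ ^ δ * (lam * ν δ) := mul_le_mul_of_nonneg_left this (by positivity)
      _ = lam * (τ ^ δ * ν δ) := by ring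
  rw [← mul_pow]
  exact pow_le_pow_left₀ hS0 hle n

/-- `Σ_{m ∈ [1,D], 3 ≤ m} x^{m−3} ≤ 1/(1−x)` for `0 ≤ x < 1`. -/
theorem sum_Icc_ite_pow_sub_three_le {x : ℝ} (hx0 : 0 ≤ x) (hx1 : x < 1) (D : ℕ) :
    ∑ m ∈ Icc 1 D, (if 3 ≤ m then x ^ (m - 3) else 0) ≤ 1 / (1 - x) := by
  rw [← sum_filter]
  have hI : (Icc 1 D).filter (fun m => 3 ≤ m) = Ico 3 (D + 1) := by
    ext m; simp only [mem_filter, mem_Icc, mem_Ico]; omega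
  rw [hI, sum_Ico_eq_sum_range]
  have h := geom_sum_Ico_le_of_lt_one hx0 hx1 (m := 0) (n := D + 1 - 3)
  rw [pow_zero, ← range_eq_Ico] at h
  refine le_trans (le_of_eq (sum_congr rfl fun i _ => ?_)) h
  congr 1
  omega

/-- **The `λ`-stripped three-piece profile**: for `ν 1 ≤ ι₁`, `ν 2 ≤ ι₂`, `ν m ≤ A'λ^{m−2}Q'^m` (`3 ≤ m ≤ D`), `0 ≤ ν`, `τλQ' < 1`:
`Σ_{δ∈[1,D]} τ^δ ν δ ≤ τι₁ + τ²ι₂ + A'λ(τQ')³/(1−τλQ')`. -/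
theorem sum_nu_threePiece_le {D : ℕ} {τ lam Q' A' ι₁ ι₂ : ℝ} {ν : ℕ → ℝ} (hτ : 0 ≤ τ) (hlam : 0 ≤ lam) (hQ' : 0 ≤ Q') (hA' : 0 ≤ A')
    (hν0 : ∀ m, 0 ≤ ν m) (hι₁ : ν 1 ≤ ι₁) (hι₂ : ν 2 ≤ ι₂) (hprof : ∀ m, 3 ≤ m → m ≤ D → ν m ≤ A' * lam ^ (m - 2) * Q' ^ m)
    (hx : τ * lam * Q' < 1) :
    ∑ δ ∈ Icc 1 D, τ ^ δ * ν δ ≤ τ * ι₁ + τ ^ 2 * ι₂ + A' * lam * (τ * Q') ^ 3 / (1 - τ * lam * Q') := by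
  have hx0 : 0 ≤ τ * lam * Q' := by positivity
  have hι₁0 : 0 ≤ ι₁ := (hν0 1).trans hι₁
  have hι₂0 : 0 ≤ ι₂ := (hν0 2).trans hι₂
  set f : ℕ → ℝ := fun m => (if 1 = m then τ * ι₁ else 0) + (if 2 = m then τ ^ 2 * ι₂ else 0) +
    A' * lam * (τ * Q') ^ 3 * (if 3 ≤ m then (τ * lam * Q') ^ (m - 3) else 0) with hf
  have hterm : ∀ m ∈ Icc 1 D, τ ^ m * ν m ≤ f m := by
    intro m hm
    have hm1 := (mem_Icc.1 hm).1
    rw [hf]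
    dsimp only
    rcases Nat.lt_or_ge m 3 with h3 | h3
    · interval_cases m
      · simp only [if_true, show ¬ (2 : ℕ) = 1 by decide, if_false, show ¬ 3 ≤ 1 by decide, pow_one, add_zero, mul_zero]
        exact mul_le_mul_of_nonneg_left hι₁ hτ
      · simp only [show ¬ (1 : ℕ) = 2 by decide, if_false, if_true, show ¬ 3 ≤ 2 by decide, zero_add, add_zero, mul_zero]
        exact mul_le_mul_of_nonneg_left hι₂ (by positivity)
    · rw [if_neg (by omega), if_neg (by omega), if_pos h3, zero_add, zero_add]
      calc τ ^ m * ν m ≤ τ ^ m * (A' * lam ^ (m - 2) * Q' ^ m) := by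
            have := hprof m h3 (mem_Icc.1 hm).2; gcongr
        _ = A' * lam * (τ * Q') ^ 3 * (τ * lam * Q') ^ (m - 3) := by
            obtain ⟨j, rfl⟩ : ∃ j, m = j + 3 := ⟨m - 3, by omega⟩
            rw [show j + 3 - 2 = j + 1 by omega, Nat.add_sub_cancel]
            simp only [pow_succ, mul_pow]
            ring
  refine (sum_le_sum hterm).trans ?_
  rw [hf, sum_add_distrib, sum_add_distrib, sum_ite_eq, sum_ite_eq, ← mul_sum]
  have h1 : (if 1 ∈ Icc 1 D then τ * ι₁ else 0) ≤ τ * ι₁ := by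
    split_ifs
    · exact le_rfl
    · positivity
  have h2 : (if 2 ∈ Icc 1 D then τ ^ 2 * ι₂ else 0) ≤ τ ^ 2 * ι₂ := by
    split_ifs
    · exact le_rfl
    · positivity
  have h3 : A' * lam * (τ * Q') ^ 3 * ∑ m ∈ Icc 1 D, (if 3 ≤ m then (τ * lam * Q') ^ (m - 3) else 0) ≤
      A' * lam * (τ * Q') ^ 3 * (1 / (1 - τ * lam * Q')) :=
    mul_le_mul_of_nonneg_left (sum_Icc_ite_pow_sub_three_le hx0 hx D) (by positivity)
  calc _ ≤ τ * ι₁ + τ ^ 2 * ι₂ + A' * lam * (τ * Q') ^ 3 * (1 / (1 - τ * lam * Q')) := add_le_add_three h1 h2 h3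
    _ = _ := by rw [mul_one_div]

/-- **First order at output degree four from the recursive profile**: `towerFO D σ μ 2` reads `μ` in degrees `2m ≥ 6` only, so
`μ m ≤ A'λ^{m−1}Q'^m` (`3 ≤ m ≤ D`) gives `towerFO D σ μ 2 ≤ λ²·64·A'σQ'³/(1 − x₁)`, `x₁ = 4σλQ' < 1` (`towerFO_le` at `p = 2` with the degrees
`≤ 4` zeroed; `A'λ(4Q')²·x₁ = 64A'σQ'³λ²`). -/
theorem towerFO_two_le {D : ℕ} {σ A' lam Q' : ℝ} {μ : ℕ → ℝ} (hσ : 0 ≤ σ) (hA' : 0 ≤ A') (hlam : 0 ≤ lam) (hQ' : 0 ≤ Q')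
    (hμ0 : ∀ m, 0 ≤ μ m) (hprof : ∀ m, 3 ≤ m → m ≤ D → μ m ≤ A' * lam ^ (m - 1) * Q' ^ m) (hx₁ : 4 * σ * lam * Q' < 1) :
    towerFO D σ μ 2 ≤ lam ^ 2 * (64 * A' * σ * Q' ^ 3 / (1 - 4 * σ * lam * Q')) := by
  set μ' : ℕ → ℝ := fun m => if 3 ≤ m then μ m else 0 with hμ'
  have hμ'0 : ∀ m, 0 ≤ μ' m := fun m => by rw [hμ']; dsimp only; split_ifs; exacts [hμ0 m, le_rfl]
  have hprof' : ∀ m, 1 ≤ m → m ≤ D → μ' m ≤ A' * lam ^ (m - 1) * Q' ^ m := fun m _ hmD => by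
    rw [hμ']; dsimp only; split_ifs with h3
    · exact hprof m h3 hmD
    · positivity
  have heq : towerFO D σ μ 2 = towerFO D σ μ' 2 := by
    unfold towerFO
    refine sum_congr rfl fun m hm => ?_
    rw [hμ']; dsimp only
    rw [if_pos (by have := (mem_Ioc.1 hm).1; omega)]
  rw [heq]
  refine (towerFO_le hσ hA' hlam hQ' hμ'0 hprof' hx₁ (p := 2) (by norm_num)).trans (le_of_eq ?_)
  rw [show (2 : ℕ) - 1 = 1 from rfl, pow_one, div_eq_mul_inv, div_eq_mul_inv]
  ring

/-- **The quartic increment of a block step is `O(λ²)`.**  Inputs: `0 ≤ μ`, EVERY degree `O(λ)` — `μ m ≤ λ·ν m` on `[1, D]` with `0 ≤ ν` and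
`Σ_{δ∈[1,D]} τ^δ ν δ ≤ G′` (e.g. `sum_nu_threePiece_le`) — and the recursive profile `μ m ≤ A'λ^{m−1}Q'^m` in degrees `2m ≥ 6` (for the first
order); smallness `x₁ = 4σλQ' < 1`, `Φ·λ·G′ < 1`, `towerV D τ μ ≤ V̄` with `ΦV̄ < 1` (all `λ`-small); the suppliers' step hypothesis at `p = 2`
(∀ N ≥ 2, guard `ΦV < 1`).  Then
`b ≤ λ² · (64·A'σQ'³/(1 − x₁) + e·ψ²·Φ·G′²/(1 − ΦλG′))` — the first order from the self-contractions of the `2m ≥ 6` kernels (`λ^{m−1} ≤ λ²`), the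
order-`n` graded terms at `λⁿ ≤ λ²`; `n`-free (the block's `d` sits in `σ, τ, ψ, Φ`); no `λ`-free condition. -/
theorem towerQuarticIncrement_le {D : ℕ} {μ ν : ℕ → ℝ} {b σ Φ ψ τ lam A' Q' G' Vb : ℝ}
    (hσ : 0 ≤ σ) (hΦ : 0 ≤ Φ) (hτ : 0 ≤ τ) (hlam : 0 ≤ lam) (hA' : 0 ≤ A') (hQ' : 0 ≤ Q')
    (hμ0 : ∀ m, 0 ≤ μ m) (hν0 : ∀ m, 0 ≤ ν m) (hμν : ∀ m, 1 ≤ m → m ≤ D → μ m ≤ lam * ν m)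
    (hG' : ∑ δ ∈ Icc 1 D, τ ^ δ * ν δ ≤ G') (hprof : ∀ m, 3 ≤ m → m ≤ D → μ m ≤ A' * lam ^ (m - 1) * Q' ^ m)
    (hx₁ : 4 * σ * lam * Q' < 1) (hy : Φ * lam * G' < 1) (hVb : towerV D τ μ ≤ Vb) (hθ : Φ * Vb < 1)
    (hstep : ∀ N : ℕ, 2 ≤ N → Φ * towerV D τ μ < 1 →
      b ≤ towerFO D σ μ 2 + ∑ n ∈ Icc 2 N, exp 1 * Φ ^ (n - 1) * ψ ^ 2 * towerS D τ μ n 2 +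
        ψ ^ 2 * exp 1 * towerV D τ μ * (Φ * towerV D τ μ) ^ N / (1 - Φ * towerV D τ μ)) :
    b ≤ lam ^ 2 * (64 * A' * σ * Q' ^ 3 / (1 - 4 * σ * lam * Q') + exp 1 * ψ ^ 2 * Φ * G' ^ 2 / (1 - Φ * lam * G')) := by
  set V := towerV D τ μ with hVdef
  have hV0 : 0 ≤ V := towerV_nonneg hτ hμ0
  have hθ0 : 0 ≤ Φ * V := mul_nonneg hΦ hV0
  have hθle : Φ * V ≤ Φ * Vb := mul_le_mul_of_nonneg_left hVb hΦ
  have hθ1 : Φ * V < 1 := hθle.trans_lt hθ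
  have hθb0 : 0 ≤ Φ * Vb := hθ0.trans hθle
  have hVb0 : 0 ≤ Vb := hV0.trans hVb
  have hG'0 : 0 ≤ G' := (sum_nonneg fun δ _ => by have := hν0 δ; positivity).trans hG'
  have hy0 : 0 ≤ Φ * lam * G' := by positivity
  set F := lam ^ 2 * (64 * A' * σ * Q' ^ 3 / (1 - 4 * σ * lam * Q')) with hF
  set M := exp 1 * ψ ^ 2 * Φ * lam ^ 2 * G' ^ 2 with hM
  have hM0 : 0 ≤ M := by positivity
  set T : ℕ → ℝ := fun N => ψ ^ 2 * exp 1 * Vb * (Φ * Vb) ^ N / (1 - Φ * Vb) with hT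
  -- graded partial sums: order `n` carries `λⁿ = λ²·λ^{n−2}`
  have hGr : ∀ N, ∑ n ∈ Icc 2 N, exp 1 * Φ ^ (n - 1) * ψ ^ 2 * towerS D τ μ n 2 ≤ M * (1 / (1 - Φ * lam * G')) := by
    intro N
    have hterm : ∀ n ∈ Icc 2 N, exp 1 * Φ ^ (n - 1) * ψ ^ 2 * towerS D τ μ n 2 ≤ M * (Φ * lam * G') ^ (n - 2) := by
      intro n hn
      have hn2 : 2 ≤ n := (mem_Icc.1 hn).1
      have hS := towerS_le_pow_of_le_mul (D := D) hτ hμ0 hμν n 2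
      have hS0 : 0 ≤ ∑ δ ∈ Icc 1 D, τ ^ δ * ν δ := sum_nonneg fun δ _ => by have := hν0 δ; positivity
      have hpow : lam ^ n * (∑ δ ∈ Icc 1 D, τ ^ δ * ν δ) ^ n ≤ lam ^ n * G' ^ n :=
        mul_le_mul_of_nonneg_left (pow_le_pow_left₀ hS0 hG' n) (by positivity)
      calc exp 1 * Φ ^ (n - 1) * ψ ^ 2 * towerS D τ μ n 2 ≤ exp 1 * Φ ^ (n - 1) * ψ ^ 2 * (lam ^ n * G' ^ n) := by
            have := towerS_nonneg hτ hμ0 n 2 (D := D); have := hS.trans hpow; gcongr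
        _ = M * (Φ * lam * G') ^ (n - 2) := by
            rw [hM]
            obtain ⟨j, rfl⟩ : ∃ j, n = j + 2 := ⟨n - 2, by omega⟩
            rw [show j + 2 - 1 = j + 1 by omega, Nat.add_sub_cancel]
            simp only [pow_succ, mul_pow]
            ring
    refine (sum_le_sum hterm).trans ?_
    rw [← mul_sum]
    refine mul_le_mul_of_nonneg_left ?_ hM0
    -- `Σ_{n ∈ [2, N]} y^{n−2} ≤ 1/(1−y)`
    have hI : Icc 2 N = Ico 2 (N + 1) := by ext m; simp only [mem_Icc, mem_Ico]; omega
    rw [hI, sum_Ico_eq_sum_range]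
    have h := geom_sum_Ico_le_of_lt_one hy0 hy (m := 0) (n := N + 1 - 2)
    rw [pow_zero, ← range_eq_Ico] at h
    refine le_trans (le_of_eq (sum_congr rfl fun i _ => ?_)) h
    congr 1
    omega
  -- tail
  have hTail : ∀ N, ψ ^ 2 * exp 1 * V * (Φ * V) ^ N / (1 - Φ * V) ≤ T N := by
    intro N
    have h1 : 0 < 1 - Φ * Vb := sub_pos.2 hθ
    have h2 : 1 - Φ * Vb ≤ 1 - Φ * V := by linarith
    rw [hT]
    dsimp only
    rw [div_eq_mul_inv, div_eq_mul_inv]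
    have hinv : (1 - Φ * V)⁻¹ ≤ (1 - Φ * Vb)⁻¹ := inv_anti₀ h1 h2
    have hpowN : (Φ * V) ^ N ≤ (Φ * Vb) ^ N := pow_le_pow_left₀ hθ0 hθle N
    have : 0 ≤ (1 - Φ * V)⁻¹ := inv_nonneg.2 (sub_nonneg.2 hθ1.le)
    gcongr
  have hFO := towerFO_two_le hσ hA' hlam hQ' hμ0 hprof hx₁ (D := D)
  have hbN : ∀ N, 2 ≤ N → b ≤ F + M * (1 / (1 - Φ * lam * G')) + T N := fun N hN =>
    (hstep N hN hθ1).trans (add_le_add_three hFO (hGr N) (hTail N))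
  have hTto : Filter.Tendsto T Filter.atTop (nhds 0) := by
    have h := (tendsto_pow_atTop_nhds_zero_of_lt_one hθb0 hθ).mul_const ((1 - Φ * Vb)⁻¹) |>.const_mul (ψ ^ 2 * exp 1 * Vb)
    rw [zero_mul, mul_zero] at h
    refine h.congr' (Filter.Eventually.of_forall fun N => ?_)
    rw [hT]
    dsimp only
    rw [div_eq_mul_inv]
    ring
  have hlim : Filter.Tendsto (fun N => F + M * (1 / (1 - Φ * lam * G')) + T N) Filter.atTop (nhds (F + M * (1 / (1 - Φ * lam * G')))) := by
    have := hTto.const_add (F + M * (1 / (1 - Φ * lam * G')))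
    rwa [add_zero] at this
  have hb := ge_of_tendsto hlim (Filter.eventually_atTop.2 ⟨2, fun N hN => hbN N hN⟩)
  refine hb.trans (le_of_eq ?_)
  rw [hF, hM]
  ring

end Summit.HubbardSuperconductivity.HubbardSuperconductivity.Theorems.EngineV8

end
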